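import Literature.AlgebraicGeometry.Frobenioids.SupportsRealAction
import Literature.AlgebraicGeometry.Frobenioids.RealPowNNRealLinear
import HarnessLib

/-!
# Frobenioids I, Def. 2.4 (ii): the `ℝ_{>0}`-action on `ℝ_{≥0}` is multiplication; `ℝ_{≥0}`-valued homomorphisms
# of `ℝ`-supported monoids are `ℝ_{≥0}`-linear

Mochizuki, *The geometry of Frobenioids I*, Kyushu J. Math. **62** (2008), Def. 2.4 (ii) p. 48: "Note that if `Λ`
supports `M`, then `Λ_{>0}` acts naturally on `M`" — for `Λ = ℝ` the action `(r, a) ↦ a^r` (tree: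
`Supports.realPow`, seat abc-iut-L1-d2) [cite: MochizukiFrdI2008, Def. 2.4(ii) p.48]; used in Thm. 6.4 (ii) p. 114
(degrees of realified Frobenioids are compared `ℝ`-linearly: "`deg(Ψ^rlf) · δ`").

PROOF-ONLY.  Two consequences of `nnreal_map_eq_mul_of_map_add` ("additive self-maps of `ℝ_{≥0}` are linear",
`RealPowNNRealLinear.lean`):
* `Supports.hom_nnreal_realPow` — for an `ℝ`-supported monoid `M` and ANY homomorphism `φ : M → ℝ_{≥0}`:
  `φ(a^r) = r · φ(a)` (additively);
* `Supports.realPow_nnreal` — on `M = ℝ_{≥0}` itself (for any witness `hS` that `ℝ` supports `ℝ_{≥0}`) the action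
  IS multiplication: `(x)^r = r · x`, i.e. the abstractly defined `realPow` (through realification coordinates)
  agrees with the arithmetic of `ℝ_{≥0}`.
Seat abc-iut-L1-d2 (cell abc-iut).
-/

noncomputable section

namespace Literature.AlgebraicGeometry.Frobenioids

open Function NNReal

universe u

namespace Supports

variable {M : Type u} [CommMonoid M]

/-- **`ℝ_{≥0}`-valued homomorphisms of an `ℝ`-supported monoid are `ℝ_{≥0}`-linear**: `φ(a^r) = r · φ(a)`
(`r ↦ φ(a^r)` is additive in `r`). [cite: MochizukiFrdI2008, Def. 2.4(ii) p.48] -/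
theorem hom_nnreal_realPow (hS : Supports M .R) (φ : M →* Multiplicative ℝ≥0) (r : NNReal) (a : M) :
    Multiplicative.toAdd (φ (hS.realPow r a)) = r * Multiplicative.toAdd (φ a) := by
  have hadd : ∀ s t : ℝ≥0, Multiplicative.toAdd (φ (hS.realPow (s + t) a)) =
      Multiplicative.toAdd (φ (hS.realPow s a)) + Multiplicative.toAdd (φ (hS.realPow t a)) := by
    intro s t
    rw [realPow_add, map_mul, toAdd_mul]
  have := nnreal_map_eq_mul_of_map_add (fun s => Multiplicative.toAdd (φ (hS.realPow s a))) hadd r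
  simpa only [realPow_one] using this

/-- **On `ℝ_{≥0}` the `ℝ_{>0}`-action of Def. 2.4 (ii) is multiplication**: `realPow r x = r · x` (additive
coordinates), for any witness `hS : Supports ℝ_{≥0} ℝ`. [cite: MochizukiFrdI2008, Def. 2.4(ii) p.48] -/
theorem realPow_nnreal (hS : Supports (Multiplicative ℝ≥0) .R) (r x : NNReal) :
    hS.realPow r (Multiplicative.ofAdd x) = Multiplicative.ofAdd (r * x) := by
  have h := hom_nnreal_realPow hS (MonoidHom.id _) r (Multiplicative.ofAdd x)
  simp only [MonoidHom.id_apply, toAdd_ofAdd] at h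
  rw [← h, ofAdd_toAdd]

/-- The same in multiplicative form: `toAdd (realPow r y) = r · toAdd y` on `ℝ_{≥0}`.
[cite: MochizukiFrdI2008, Def. 2.4(ii) p.48] -/
theorem toAdd_realPow_nnreal (hS : Supports (Multiplicative ℝ≥0) .R) (r : NNReal) (y : Multiplicative ℝ≥0) :
    Multiplicative.toAdd (hS.realPow r y) = r * Multiplicative.toAdd y := by
  rw [← ofAdd_toAdd y, realPow_nnreal, toAdd_ofAdd, toAdd_ofAdd]

end Supports

end Literature.AlgebraicGeometry.Frobenioids
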